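import Summits.QuantumFields.YangMills.Theorems.LuscherReductionTwistedTraceScalingTubeFloorGlue
import Summits.QuantumFields.YangMills.Theorems.LuscherReductionTwistedTraceScalingAvgKernelColourBased
import Summits.QuantumFields.YangMills.Theorems.LuscherReductionOneSiteLevelsIMS
import Summits.QuantumFields.YangMills.Theorems.FemtoTransferGapSlabRayleigh
import Summits.QuantumFields.YangMills.Theorems.FemtoTransferGapPositivity
import HarnessLib

/-!
# (B-ST) step (A): THE TUBE FORM IS AT MOST THE TRANSFER FORM OF THE BASED AVERAGE — `T(v) ≤ ⟨P₀v, K_β P₀v⟩` — the colour twist is free for UPPER bounds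
# (lane A of S-BASE, crux `TwistedTraceScaling` stmt-QuantumFields-20203, C4-CORE, the (B-ST) pen; design card `pub/ym-fleet/ym-luscher-20007-p1/Lines-BST-poincare.md` (A))

The gauge average factors as colour average ∘ based average (`…AvgKernelColourBased`); the colour rotation twists slow and fibre variables jointly (cdisprove R32/R33), which is
what makes the averaged kernel `K̃_β` NOT a product on core × core.  For the stability brick (B-ST) only an UPPER bound on `T(v) = ⟨gaugeAvg v, K_β gaugeAvg v⟩` is needed, and
for upper bounds the colour average can simply be DROPPED: averaging over a compact group acting by measure-preserving symmetries of a positive semi-definite form never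
increases the form.  This file (no definitions; the based average is written as the explicit integral `U ↦ ∫ v(U^{basedExt h}) dh`):
* §1 the transfer form on BOUNDED MEASURABLE (not necessarily physical) functions: ★ `qform_self_nonneg_bdd` (`0 ≤ ⟨f, K_β f⟩`, the Gram-kernel argument of
  `FemtoTransferGapPositivity` verbatim), `qform_comm_bdd`, `qform_sub_sub_bdd` (bilinear expansion);
* §2 ★★ `tubeForm_le_qform` — `T(f) ≤ ⟨f, K_β f⟩` for every bounded measurable `f` (`β ≥ 0`): `0 ≤ ⟨f − Pf, K_β(f − Pf)⟩ = ⟨f,K_βf⟩ − T(f)`, `P = gaugeAvg`, using `K_β P = P K_β`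
  (`transferApply_gaugeAvg`), `∫ F·(P q) = ∫ F·q` for invariant `F` (`integral_invariant_mul_gaugeAvg`) and `T(f) = ⟨Pf, K_β Pf⟩` (`qform_gaugeAvg_eq_tubeForm`);
* §3 ★ `gaugeAvg_basedIntegral` — `gaugeAvg (U ↦ ∫ v(U^{basedExt h}) dh) = gaugeAvg v` (the gauge group contains the based subgroup), hence ★★★ `tubeForm_le_qform_basedIntegral`:
  `T(v) ≤ ⟨P₀v, K_β P₀v⟩`, `(P₀v)(U) = ∫ v(U^{basedExt h}) dh` — equality when `v` is colour invariant (so the Born–Oppenheimer top is untouched), and the right side is the form of the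
  UNTWISTED based-averaged kernel `G(U,V) = ∫ K_β(U, V^{basedExt h}) dh`, which IS a product on core × core by the exact transport `…BOTransport.transferKernel_orthoTube_transport`.
HONEST FRAMING: exact bookkeeping for a stub of a child of the CONDITIONAL route R2b1; (B-ST) OPEN; C4-CORE OPEN; not infinite volume, not a gap, not Clay.
-/

set_option autoImplicit false

noncomputable section

open MeasureTheory Filter Topology Real
open scoped BigOperators
open Literature.MathematicalPhysics.QuantumFieldTheory
open Literature.MathematicalPhysics.QuantumLattice

namespace Summit.QuantumFields.YangMills.Theorems.FemtoTransferGap.TwoLattice.ConstTube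

open Summit.QuantumFields.YangMills.Theorems.FemtoTransferGap
open Summit.QuantumFields.YangMills.Theorems.FemtoTransferGap.TwoLattice.Avg

variable {L : ℕ} [NeZero L]

/-! ## §1 The transfer form on bounded measurable functions -/

/-- The product integrand `f(U)K_β(U,V)g(V)` is bounded measurable, hence integrable on `configMeasure ⊗ configMeasure`. [folklore] -/
theorem integrable_qform_integrand (β : ℝ) {f g : GaugeConfig 3 L SU2 → ℝ} (hf : Measurable f) {Cf : ℝ} (hCf : ∀ U, |f U| ≤ Cf) (hg : Measurable g) {Cg : ℝ}
    (hCg : ∀ U, |g U| ≤ Cg) :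
    Integrable (fun p : GaugeConfig 3 L SU2 × GaugeConfig 3 L SU2 => f p.1 * transferKernel su2Rep β p.1 p.2 * g p.2) ((configMeasure SU2 L).prod (configMeasure SU2 L)) := by
  haveI : SecondCountableTopology SU2 := secondCountableTopology_su2
  obtain ⟨M, hM⟩ := exists_transferKernel_le su2Rep continuous_su2Rep β (L := L)
  have hCf0 : 0 ≤ Cf := (abs_nonneg _).trans (hCf 1)
  have hK : Measurable fun p : GaugeConfig 3 L SU2 × GaugeConfig 3 L SU2 => transferKernel su2Rep β p.1 p.2 :=
    (continuous_transferKernel su2Rep continuous_su2Rep β).measurable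
  refine integrable_of_measurable_abs_le _ (((hf.comp measurable_fst).mul hK).mul (hg.comp measurable_snd)) (C := Cf * M * Cg) fun p => ?_
  rw [abs_mul, abs_mul, abs_of_pos (transferKernel_pos su2Rep β _ _)]
  exact mul_le_mul (mul_le_mul (hCf _) (hM _ _) (transferKernel_pos su2Rep β _ _).le hCf0) (hCg _) (abs_nonneg _)
    (mul_nonneg hCf0 ((transferKernel_pos su2Rep β p.1 p.2).le.trans (hM _ _)))

/-- `⟨f, K_β g⟩` as a product integral. [folklore] -/
theorem qform_eq_integral_prod_bdd (β : ℝ) {f g : GaugeConfig 3 L SU2 → ℝ} (hf : Measurable f) {Cf : ℝ} (hCf : ∀ U, |f U| ≤ Cf) (hg : Measurable g) {Cg : ℝ}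
    (hCg : ∀ U, |g U| ≤ Cg) :
    qform su2Rep β f g = ∫ p, f p.1 * transferKernel su2Rep β p.1 p.2 * g p.2 ∂(configMeasure SU2 L).prod (configMeasure SU2 L) := by
  unfold qform
  exact (integral_prod _ (integrable_qform_integrand β hf hCf hg hCg)).symm

/-- ★ `⟨f, K_β g⟩ = ⟨g, K_β f⟩` for bounded measurable `f, g`. [cite: SeilerLNP1982, §3] -/
theorem qform_comm_bdd (β : ℝ) {f g : GaugeConfig 3 L SU2 → ℝ} (hf : Measurable f) {Cf : ℝ} (hCf : ∀ U, |f U| ≤ Cf) (hg : Measurable g) {Cg : ℝ}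
    (hCg : ∀ U, |g U| ≤ Cg) : qform su2Rep β f g = qform su2Rep β g f := by
  rw [qform_eq_integral_prod_bdd β hf hCf hg hCg, qform_eq_integral_prod_bdd β hg hCg hf hCf, ← integral_prod_swap]
  refine integral_congr_ae (ae_of_all _ fun p => ?_)
  simp only [Prod.fst_swap, Prod.snd_swap, transferKernel_su2Rep_symm β p.2 p.1]
  ring

/-- ★ **Bilinear expansion**: `⟨f − g, K_β (f − g)⟩ = ⟨f,K_βf⟩ − ⟨f,K_βg⟩ − ⟨g,K_βf⟩ + ⟨g,K_βg⟩` for bounded measurable `f, g`. [folklore] -/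
theorem qform_sub_sub_bdd (β : ℝ) {f g : GaugeConfig 3 L SU2 → ℝ} (hf : Measurable f) {Cf : ℝ} (hCf : ∀ U, |f U| ≤ Cf) (hg : Measurable g) {Cg : ℝ}
    (hCg : ∀ U, |g U| ≤ Cg) :
    qform su2Rep β (fun U => f U - g U) (fun U => f U - g U) = qform su2Rep β f f - qform su2Rep β f g - qform su2Rep β g f + qform su2Rep β g g := by
  have hd : Measurable fun U => f U - g U := hf.sub hg
  have hdb : ∀ U, |f U - g U| ≤ Cf + Cg := fun U => (abs_sub _ _).trans (add_le_add (hCf U) (hCg U))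
  rw [qform_eq_integral_prod_bdd β hd hdb hd hdb, qform_eq_integral_prod_bdd β hf hCf hf hCf, qform_eq_integral_prod_bdd β hf hCf hg hCg,
    qform_eq_integral_prod_bdd β hg hCg hf hCf, qform_eq_integral_prod_bdd β hg hCg hg hCg]
  have i1 := integrable_qform_integrand β hf hCf hf hCf
  have i2 := integrable_qform_integrand β hf hCf hg hCg
  have i3 := integrable_qform_integrand β hg hCg hf hCf
  have i4 := integrable_qform_integrand β hg hCg hg hCg
  have i12 : Integrable (fun p : GaugeConfig 3 L SU2 × GaugeConfig 3 L SU2 =>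
      f p.1 * transferKernel su2Rep β p.1 p.2 * f p.2 - f p.1 * transferKernel su2Rep β p.1 p.2 * g p.2) ((configMeasure SU2 L).prod (configMeasure SU2 L)) := i1.sub i2
  have i123 : Integrable (fun p : GaugeConfig 3 L SU2 × GaugeConfig 3 L SU2 =>
      f p.1 * transferKernel su2Rep β p.1 p.2 * f p.2 - f p.1 * transferKernel su2Rep β p.1 p.2 * g p.2 - g p.1 * transferKernel su2Rep β p.1 p.2 * f p.2)
      ((configMeasure SU2 L).prod (configMeasure SU2 L)) := i12.sub i3
  rw [← integral_sub i1 i2, ← integral_sub i12 i3, ← integral_add i123 i4]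
  refine integral_congr_ae (ae_of_all _ fun p => ?_)
  ring

/-- ★ **`0 ≤ ⟨f, K_β f⟩` for every BOUNDED MEASURABLE `f`** (`β ≥ 0`): the Gram-kernel positivity of `FemtoTransferGapPositivity`, with the physical test function replaced by a bounded
measurable one (only boundedness and measurability were used there). [cite: OsterwalderSeiler1978, §2] -/
theorem qform_self_nonneg_bdd {β : ℝ} (hβ : 0 ≤ β) {f : GaugeConfig 3 L SU2 → ℝ} (hf : Measurable f) {Cf : ℝ} (hCf : ∀ U, |f U| ≤ Cf) : 0 ≤ qform su2Rep β f f := by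
  haveI : SecondCountableTopology SU2 := secondCountableTopology_su2
  have hC0 : 0 ≤ Cf := (abs_nonneg _).trans (hCf 1)
  -- the weight `w = e^{−(β/2) S}` and `Φ = f w`
  have hw_cont : Continuous fun U : GaugeConfig 3 L SU2 => Real.exp (-(β / 2) * wilsonAction su2Rep U) :=
    Real.continuous_exp.comp (continuous_const.mul (continuous_wilsonAction su2Rep continuous_su2Rep))
  obtain ⟨W, hW⟩ := (isCompact_range hw_cont).bddAbove
  have hWle : ∀ U, Real.exp (-(β / 2) * wilsonAction su2Rep U) ≤ W := fun U => hW (Set.mem_range_self U)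
  set Φ : GaugeConfig 3 L SU2 → ℝ := fun U => f U * Real.exp (-(β / 2) * wilsonAction su2Rep U) with hΦdef
  have hΦm : Measurable Φ := hf.mul hw_cont.measurable
  have hΦb : ∀ U, |Φ U| ≤ Cf * W := fun U => by
    rw [hΦdef, abs_mul, abs_of_pos (Real.exp_pos _)]
    exact mul_le_mul (hCf U) (hWle U) (Real.exp_pos _).le hC0
  have hCW : 0 ≤ Cf * W := (abs_nonneg _).trans (hΦb 1)
  have hgm : ∀ a, Measurable (suFeature 2 L a) := fun a => (continuous_suFeature L a).measurable
  have hgb : ∀ a U, |suFeature 2 L a U| ≤ 1 := abs_suFeature_le_one L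
  have hTm : Measurable fun p : GaugeConfig 3 L SU2 × GaugeConfig 3 L SU2 => ∑ a, suFeature 2 L a p.1 * suFeature 2 L a p.2 := measurable_gram _ hgm
  have hTb := fun p : GaugeConfig 3 L SU2 × GaugeConfig 3 L SU2 => abs_gram_le (suFeature 2 L) zero_le_one hgb p.1 p.2
  have hK : ∀ U V, f U * transferKernel su2Rep β U V * f V = Φ U * Real.exp (β * ∑ a, suFeature 2 L a U * suFeature 2 L a V) * Φ V := by
    intro U V
    rw [← timeCoupling_fundamentalRep_eq_gram, hΦdef]
    simp only [transferKernel]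
    rw [show β * timeCoupling su2Rep U V - β / 2 * (wilsonAction su2Rep U + wilsonAction su2Rep V) =
        β * timeCoupling su2Rep U V + -(β / 2) * wilsonAction su2Rep U + -(β / 2) * wilsonAction su2Rep V by ring, Real.exp_add, Real.exp_add]
    ring
  have hint : Integrable (fun p : GaugeConfig 3 L SU2 × GaugeConfig 3 L SU2 => Φ p.1 * Real.exp (β * ∑ a, suFeature 2 L a p.1 * suFeature 2 L a p.2) * Φ p.2)
      ((configMeasure _ L).prod (configMeasure _ L)) := by
    refine integrable_sandwich (configMeasure _ L) (H := fun p => Real.exp (β * ∑ a, suFeature 2 L a p.1 * suFeature 2 L a p.2)) (hTm.const_mul β).exp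
      (R := Real.exp (β * (Fintype.card (Edge 3 L × (Fin 2 × Fin 2) × Bool) * 1 ^ 2))) (fun p => ?_) hΦm hΦb
    show |Real.exp (β * ∑ a, suFeature 2 L a p.1 * suFeature 2 L a p.2)| ≤ _
    rw [abs_of_pos (Real.exp_pos _)]
    refine Real.exp_le_exp.mpr ?_
    exact (le_abs_self _).trans (by rw [abs_mul, abs_of_nonneg hβ]; exact mul_le_mul_of_nonneg_left (hTb p) hβ)
  have hq : qform su2Rep β f f = ∫ p, Φ p.1 * Real.exp (β * ∑ a, suFeature 2 L a p.1 * suFeature 2 L a p.2) * Φ p.2 ∂(configMeasure _ L).prod (configMeasure _ L) := by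
    unfold qform
    simp_rw [hK]
    exact (integral_prod _ hint).symm
  rw [hq]
  exact integral_prod_exp_gram_nonneg (configMeasure SU2 L) (suFeature 2 L) hgm zero_le_one hgb Φ hΦm hCW hΦb hβ

/-! ## §2 ★★ The tube form is at most the transfer form -/

/-- `⟨f, K_β (gaugeAvg f)⟩ = T(f)` for bounded measurable `f`: `K_β` commutes with the average and `gaugeAvg f` is invariant. [cite: SeilerLNP1982, §3] -/
theorem qform_gaugeAvg_right_eq_tubeForm (β : ℝ) {f : GaugeConfig 3 L SU2 → ℝ} (hf : Measurable f) {Cf : ℝ} (hCf : ∀ U, |f U| ≤ Cf) :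
    qform su2Rep β (gaugeAvg f) f = tubeForm β f := by
  haveI : SecondCountableTopology SU2 := secondCountableTopology_su2
  obtain ⟨M, hM⟩ := exists_transferKernel_le su2Rep continuous_su2Rep β (L := L)
  have hAm : Measurable (gaugeAvg f) := measurable_gaugeAvg hf
  have hAb : ∀ U, |gaugeAvg f U| ≤ Cf := abs_gaugeAvg_le hf hCf
  have hAinv : ∀ (g : Site 3 L → SU2) (U : GaugeConfig 3 L SU2), gaugeAvg f (gaugeTransform g U) = gaugeAvg f U := fun g U => gaugeAvg_gaugeTransform f g U
  have hKm : Measurable (transferApply β f) := measurable_transferApply β hf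
  have hKb : ∀ U, |transferApply β f U| ≤ M * Cf := abs_transferApply_le β hM hf hCf
  -- `⟨Pf, K f⟩ = ∫ Pf·(Kf) = ∫ Pf·P(Kf) = ∫ Pf·K(Pf) = ⟨Pf, K Pf⟩ = T(f)`
  rw [qform_eq_l2_transferApply]
  unfold l2
  rw [← integral_invariant_mul_gaugeAvg hKm hKb hAm hAb hAinv]
  have e : (fun U => gaugeAvg f U * gaugeAvg (transferApply β f) U) = fun U => gaugeAvg f U * transferApply β (gaugeAvg f) U :=
    funext fun U => by rw [transferApply_gaugeAvg β hf hCf U]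
  rw [e]
  have h := qform_gaugeAvg_eq_tubeForm β hf hCf
  rw [qform_eq_l2_transferApply] at h
  exact h

/-- ★★ **`T(f) ≤ ⟨f, K_β f⟩` for every bounded measurable `f`** (`β ≥ 0`): `0 ≤ ⟨f − Pf, K_β(f − Pf)⟩ = ⟨f, K_βf⟩ − T(f)`, `P = gaugeAvg`. [cite: SeilerLNP1982, §3] -/
theorem tubeForm_le_qform {β : ℝ} (hβ : 0 ≤ β) {f : GaugeConfig 3 L SU2 → ℝ} (hf : Measurable f) {Cf : ℝ} (hCf : ∀ U, |f U| ≤ Cf) :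
    tubeForm β f ≤ qform su2Rep β f f := by
  have hAm : Measurable (gaugeAvg f) := measurable_gaugeAvg hf
  have hAb : ∀ U, |gaugeAvg f U| ≤ Cf := abs_gaugeAvg_le hf hCf
  have h0 := qform_self_nonneg_bdd (L := L) hβ (hf.sub hAm) (Cf := Cf + Cf) fun U => (abs_sub _ _).trans (add_le_add (hCf U) (hAb U))
  have hexp := qform_sub_sub_bdd β hf hCf hAm hAb
  have e1 : qform su2Rep β (gaugeAvg f) f = tubeForm β f := qform_gaugeAvg_right_eq_tubeForm β hf hCf
  have e2 : qform su2Rep β f (gaugeAvg f) = tubeForm β f := by rw [qform_comm_bdd β hf hCf hAm hAb]; exact e1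
  have e3 : qform su2Rep β (gaugeAvg f) (gaugeAvg f) = tubeForm β f := qform_gaugeAvg_eq_tubeForm β hf hCf
  have hfun : (fun U => f U - gaugeAvg f U) = f - gaugeAvg f := rfl
  rw [hfun] at hexp
  rw [hexp, e1, e2, e3] at h0
  linarith

/-! ## §3 ★★★ The based average: `T(v) ≤ ⟨P₀v, K_β P₀v⟩` -/

omit [NeZero L] in
/-- The integrand `(U, h) ↦ v(U^{basedExt h})` is jointly measurable. [folklore] -/
theorem measurable_comp_basedAction {v : GaugeConfig 3 L SU2 → ℝ} (hv : Measurable v) :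
    Measurable fun p : GaugeConfig 3 L SU2 × (NzSite L → SU2) => v (gaugeTransform (basedExt L p.2) p.1) := by
  have h1 : Measurable fun p : GaugeConfig 3 L SU2 × (NzSite L → SU2) => (p.1, basedExt L p.2) := measurable_fst.prodMk ((measurable_basedExt L).comp measurable_snd)
  have h := (measurable_comp_gaugeAction hv).comp h1
  simpa only [Function.comp_def] using h

/-- The based integral `U ↦ ∫ v(U^{basedExt h}) dh` is measurable and bounded by the bound of `v`. [folklore] -/
theorem basedIntegral_props {v : GaugeConfig 3 L SU2 → ℝ} (hv : Measurable v) {Cv : ℝ} (hCv : ∀ U, |v U| ≤ Cv) :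
    Measurable (fun U => ∫ h, v (gaugeTransform (basedExt L h) U) ∂basedMeasure L) ∧ ∀ U, |∫ h, v (gaugeTransform (basedExt L h) U) ∂basedMeasure L| ≤ Cv := by
  haveI : IsProbabilityMeasure (basedMeasure L) := by unfold basedMeasure; infer_instance
  refine ⟨((measurable_comp_basedAction hv).stronglyMeasurable.integral_prod_right' (ν := basedMeasure L)).measurable, fun U => ?_⟩
  have h := norm_integral_le_of_norm_le_const (μ := basedMeasure L) (f := fun h => v (gaugeTransform (basedExt L h) U)) (C := Cv)
    (Filter.Eventually.of_forall fun h => by rw [Real.norm_eq_abs]; exact hCv _)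
  rw [Real.norm_eq_abs] at h
  simpa using h

/-- ★ **The gauge average absorbs the based average**: `gaugeAvg (U ↦ ∫ v(U^{basedExt h}) dh) = gaugeAvg v` (Fubini; left invariance of Haar on the gauge group under the based
subgroup). [folklore] -/
theorem gaugeAvg_basedIntegral {v : GaugeConfig 3 L SU2 → ℝ} (hv : Measurable v) {Cv : ℝ} (hCv : ∀ U, |v U| ≤ Cv) (U : GaugeConfig 3 L SU2) :
    gaugeAvg (fun U => ∫ h, v (gaugeTransform (basedExt L h) U) ∂basedMeasure L) U = gaugeAvg v U := by
  haveI : IsProbabilityMeasure (basedMeasure L) := by unfold basedMeasure; infer_instance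
  haveI : IsProbabilityMeasure (gaugeMeasure L) := by unfold gaugeMeasure; infer_instance
  unfold gaugeAvg
  -- joint integrand `(g, h) ↦ v(U^{basedExt h · g})`
  have hJ : Measurable fun p : (Site 3 L → SU2) × (NzSite L → SU2) => v (gaugeTransform (basedExt L p.2 * p.1) U) := by
    have h1 : Measurable fun p : (Site 3 L → SU2) × (NzSite L → SU2) => basedExt L p.2 * p.1 := ((measurable_basedExt L).comp measurable_snd).mul measurable_fst
    exact (measurable_comp_gaugeTransform_left hv U).comp h1
  have hJb : ∀ p : (Site 3 L → SU2) × (NzSite L → SU2), |v (gaugeTransform (basedExt L p.2 * p.1) U)| ≤ Cv := fun p => hCv _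
  have hint : Integrable (fun p : (Site 3 L → SU2) × (NzSite L → SU2) => v (gaugeTransform (basedExt L p.2 * p.1) U)) ((gaugeMeasure L).prod (basedMeasure L)) :=
    integrable_of_measurable_abs_le _ hJ hJb
  calc ∫ g, ∫ h, v (gaugeTransform (basedExt L h) (gaugeTransform g U)) ∂basedMeasure L ∂gaugeMeasure L
      = ∫ g, ∫ h, v (gaugeTransform (basedExt L h * g) U) ∂basedMeasure L ∂gaugeMeasure L := by
        simp only [gaugeTransform_gaugeTransform]
    _ = ∫ h, ∫ g, v (gaugeTransform (basedExt L h * g) U) ∂gaugeMeasure L ∂basedMeasure L := integral_integral_swap hint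
    _ = ∫ h, ∫ g, v (gaugeTransform g U) ∂gaugeMeasure L ∂basedMeasure L := by
        refine integral_congr_ae (ae_of_all _ fun h => ?_)
        dsimp only
        exact integral_mul_left_eq_self (fun g => v (gaugeTransform g U)) (basedExt L h)
    _ = ∫ g, v (gaugeTransform g U) ∂gaugeMeasure L := by simp [integral_const]

/-- ★★★ **`T(v) ≤ ⟨P₀v, K_β P₀v⟩`**, `(P₀v)(U) = ∫ v(U^{basedExt h}) dh`, for every bounded measurable `v` and `β ≥ 0`: the colour average is free for upper bounds.
[cite: SeilerLNP1982, §3] [cite: Luscher1983, §3] -/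
theorem tubeForm_le_qform_basedIntegral {β : ℝ} (hβ : 0 ≤ β) {v : GaugeConfig 3 L SU2 → ℝ} (hv : Measurable v) {Cv : ℝ} (hCv : ∀ U, |v U| ≤ Cv) :
    tubeForm β v ≤ qform su2Rep β (fun U => ∫ h, v (gaugeTransform (basedExt L h) U) ∂basedMeasure L) (fun U => ∫ h, v (gaugeTransform (basedExt L h) U) ∂basedMeasure L) := by
  obtain ⟨hPm, hPb⟩ := basedIntegral_props (L := L) hv hCv
  -- `T(v) = T(P₀v)` since both are the transfer form of the same gauge average
  have hT : tubeForm β v = tubeForm β (fun U => ∫ h, v (gaugeTransform (basedExt L h) U) ∂basedMeasure L) := by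
    rw [← qform_gaugeAvg_eq_tubeForm β hv hCv, ← qform_gaugeAvg_eq_tubeForm β hPm hPb]
    have e : gaugeAvg (fun U => ∫ h, v (gaugeTransform (basedExt L h) U) ∂basedMeasure L) = gaugeAvg v := funext fun U => gaugeAvg_basedIntegral hv hCv U
    rw [e]
  rw [hT]
  exact tubeForm_le_qform hβ hPm hPb

/-- The right side in kernel form: `⟨P₀v, K_β P₀v⟩ = ∫∫ (P₀v)(U) K_β(U,V) (P₀v)(V)` with the based average displayed — the quadratic form to which the Poincaré door
`…BOStiffDoor.form_le_of_quasimode_of_comparison` is applied in the (B-ST) assembly. [folklore] -/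
theorem tubeForm_le_integral_basedIntegral {β : ℝ} (hβ : 0 ≤ β) {v : GaugeConfig 3 L SU2 → ℝ} (hv : Measurable v) {Cv : ℝ} (hCv : ∀ U, |v U| ≤ Cv) :
    tubeForm β v ≤ ∫ U, ∫ V, (∫ h, v (gaugeTransform (basedExt L h) U) ∂basedMeasure L) * transferKernel su2Rep β U V *
      (∫ h, v (gaugeTransform (basedExt L h) V) ∂basedMeasure L) ∂configMeasure SU2 L ∂configMeasure SU2 L :=
  tubeForm_le_qform_basedIntegral hβ hv hCv

end Summit.QuantumFields.YangMills.Theorems.FemtoTransferGap.TwoLattice.ConstTube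

end
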